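import Summits.BirchSwinnertonDyer.BirchSwinnertonDyer.Theorems.SignedBaseChangeAnticyclotomicEisensteinDivisibilitySpecializationHerbrand
import Literature.NumberTheory.IwasawaTheory.IwasawaAlgebraTwoVarRegularProofs
import Literature.NumberTheory.EllipticCurves.GreenbergSelmerNewformDatum
import Literature.NumberTheory.EllipticCurves.PadicCoeffIntegersFrobeniusData
import Literature.NumberTheory.EllipticCurves.NewformsCoeffFieldHolds
import Literature.NumberTheory.GaloisRepresentations.PadicAlgClFiniteSubextensionDvr
import Literature.NumberTheory.EllipticCurves.IwasawaAlgebraPseudoNullProofs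
import HarnessLib

/-!
# Descent of a characteristic-ideal bound along `T_c ↦ 0` through a control map — the algebra of
# [JSW17, Cor. 3.4.2] in the tree's `Module.charIdeal` currency — and the factoriality of `𝒪⟦T_a⟧⟦T_c⟧`
# for the coefficient ring `𝒪 = padicCoeffIntegers ι_g` of a newform (helper, `--supports
# stmt-BirchSwinnertonDyer-25505`)

Cell `bsd-stepL`, seat `bsd-stepL-imc-p1` (prover g20, 2026-08-28). Theorems only (no definition, no
named fact, no `sorry`, no instance, no notation). First of two files keying crux 25505
`ErratumThm23SigmaLe` (F4♯ = Castella's erratum Thm. 2.3 «⊂» for ONE newform) to the TWO-VARIABLE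
Selmer object of [FW21, Thm. 4.41] / [JSW17, §3.4]; the companion
`ErratumRoadFiveErratumThm23OfTwoVariable.lean` composes the crux BY NAME.

[JSW17, §3.4] (held text arXiv:1512.06894 p. 14), the printed descent: "**Corollary 3.4.2.** Suppose `Σ`
contains all the finite places `w ∤ p` at which `V` is ramified. Then
`chr(X^Σ_ac(M)) ⊂ chr(X^Σ_Gr(𝓜)) mod (γ₊ − 1)`. Proof. Let `F^Σ_Gr(𝓜)` be the `Λ_K`-fitting ideal of
`X^Σ_Gr(𝓜)` … `F^Σ_Gr(𝓜) ⊂ chr(X^Σ_Gr(𝓜))`. Since the kernel of the surjection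
`X^Σ_Gr(𝓜)/(γ₊ − 1)X^Σ_Gr(𝓜) ↠ X^Σ_ac(M)` has finite order and since the source has `Λ`-Fitting ideal
equal to `F^Σ_Gr(𝓜)` modulo `(γ₊ − 1)`, there is some `c > 0` such that
`F^Σ_ac(M)𝔪_Λ^c ⊂ F^Σ_Gr(𝓜) mod (γ₊ − 1)` … `chr(X^Σ_ac(M))` is the smallest principal ideal containing
`F^Σ_ac(M)`". In the tree's length-valued `Module.charIdeal` the same statement follows WITHOUT Fitting
ideals from two tree theorems: the Herbrand specialisation formula
`PowerSeriesSpecialization.charIdeal_quotSMulTop_eq_mul` (`ch_A(N/XN) = ch_A(N[X]) · ch_{A⟦X⟧}(N)(0)`,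
bsd-wall sbc-p1 g7) and pseudo-isomorphism invariance `charIdeal_eq_of_arePseudoIsomorphic`.

* §1 `TwoVariableDescent.*` (generic, `A` a Noetherian factorial domain with `A⟦X⟧` factorial, the
  `A`-structure on `N/XN` restricted along the constants `C : A → A⟦X⟧` and written `letI` into the
  statements — NOT Mathlib's `algebraPowerSeries`, cf. the ERRATUM in `IwasawaAlgebraSpecialization.lean`):
  `isTorsion_of_isPseudoNull'` (pseudo-null ⟹ torsion over a domain),
  `isTorsion_of_isTorsion_ker_of_surjective`, `exists_constantCoeff_ne_zero_of_control` (a surjection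
  `N/XN ↠ Y` with pseudo-null kernel onto a TORSION `A`-module makes a `s` with `s(0) ≠ 0` kill the finitely
  generated `N` — so `N` is `A⟦X⟧`-torsion, `isTorsion_of_exists_constantCoeff_ne_zero`),
  **`charIdeal_le_map_constantCoeff_of_control`: `ch_A(Y) ⊆ ch_{A⟦X⟧}(N)(0)`** and
  `charIdeal_le_span_constantCoeff_of_control` (`ch(N) ⊆ (L) ⟹ ch_A(Y) ⊆ (L(0))`); transport along a
  coefficient extension `φ : A → B`: `constantCoeff_comp_map_map`, `map_map_constantCoeff_eq`,
  `map_constantCoeff_le_span_of_le_span_of_eq_unit_mul`.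
* §2 `CoeffRing.*` for `𝒪 = padicCoeffIntegers ι_g`: `isDiscreteValuationRing_unitBall`,
  **`uniqueFactorizationMonoid_powerSeries_powerSeries`** (`𝒪⟦T_a⟧⟦T_c⟧` factorial: the tree's
  `IwasawaTheory.uniqueFactorizationMonoid_powerSeries_powerSeries` for the DVR `𝒪_{ℚ_p(ι_g K_g)}`
  transported along `GreenbergSelmer.exists_ringEquiv_unitBall`), `isPrincipalIdealRing`,
  `finiteDimensional_padicCoeffField` (newform ⟹ `ℚ_p(ι_g K_g)/ℚ_p` finite).

HONEST FRAMING: pure algebra; nothing about Selmer groups, newforms or curves is asserted; BSD is proved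
for no pair; closes: none (T7).

## References

* [JetchevSkinnerWan2017] D. Jetchev, C. Skinner, X. Wan, Camb. J. Math. 5 (2017), §3.4, Cor. 3.4.2 and
  its proof (arXiv:1512.06894 p. 14).
* [SkinnerUrban2014] Invent. Math. 195 (2014), §3.1.6, Cor. 3.2.9 (ii) (p. 24).
* [Matsumura1987] Thm. 20.3; [SerreLocalFields1979] Ch. II §2 Prop. 3; [NeukirchANT1999] Ch. II (4.8);
  [Shimura1971] Thm. 3.48; Bourbaki AC VII §4.4–4.5.
-/

noncomputable section

open Function
open scoped Classical Pointwise

-- D-0017: single-problem summit, the namespace repeats the problem name by design.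
set_option linter.dupNamespace false
set_option autoImplicit false

namespace Summit.BirchSwinnertonDyer.BirchSwinnertonDyer.Theorems.ErratumThm23TwoVariable

open Literature.NumberTheory.EllipticCurves Literature.NumberTheory.EllipticCurves.Module
  Summit.BirchSwinnertonDyer.BirchSwinnertonDyer.Theorems.SignedBaseChangeAcDivSpecialization
  Summit.BirchSwinnertonDyer.BirchSwinnertonDyer.Theorems.SignedBaseChangeAcDivSpecialization.LocalLength
  Summit.BirchSwinnertonDyer.BirchSwinnertonDyer.Theorems.SignedBaseChangeAcDivSpecialization.PowerSeriesSpecialization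

/-! ## §1 Descent of an upper bound on the characteristic ideal along `X ↦ 0` through a
pseudo-isomorphic control map ([JSW17, Cor. 3.4.2] in the tree's `Module.charIdeal` currency) -/

namespace TwoVariableDescent

universe u v w

section PseudoNull

variable {R : Type u} [CommRing R] [IsDomain R] {M : Type v} [AddCommGroup M] [_root_.Module R M]

/-- Over a domain a pseudo-null module is torsion: pseudo-nullity at the height-zero prime `(0)` says
`M_{(0)} = 0`, i.e. every element is killed by a non-zero scalar. [folklore] -/
theorem isTorsion_of_isPseudoNull' (h : IsPseudoNull R M) : Module.IsTorsion R M := by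
  let 𝔭 : PrimeSpectrum R := ⟨⊥, Ideal.isPrime_bot⟩
  have h0 : 𝔭.asIdeal.height ≤ 1 := by
    rw [show 𝔭.asIdeal = ⊥ from rfl, Ideal.height_bot]; exact zero_le_one
  have hsub := h 𝔭 h0
  intro m
  obtain ⟨s, hs, hsm⟩ := LocalizedModule.subsingleton_iff.mp hsub m
  refine ⟨⟨s, mem_nonZeroDivisors_of_ne_zero fun hs0 => hs ?_⟩, hsm⟩
  rw [show 𝔭.asIdeal = ⊥ from rfl, hs0]
  exact Submodule.zero_mem _

omit [IsDomain R] in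
/-- An extension of torsion modules is torsion (for the kernel/image of a linear map). [folklore] -/
theorem isTorsion_of_isTorsion_ker_of_surjective {N : Type w} [AddCommGroup N] [_root_.Module R N]
    (f : M →ₗ[R] N) (hK : Module.IsTorsion R (LinearMap.ker f)) (hN : Module.IsTorsion R N) :
    Module.IsTorsion R M := by
  intro m
  obtain ⟨a, ha⟩ := @hN (f m)
  have hmem : (a : R) • m ∈ LinearMap.ker f := by
    rw [LinearMap.mem_ker, map_smul]
    exact ha
  obtain ⟨b, hb⟩ := @hK ⟨(a : R) • m, hmem⟩
  refine ⟨b * a, ?_⟩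
  have hb' : (b : R) • ((a : R) • m) = 0 := by
    have := congrArg Subtype.val hb
    simpa [Submonoid.smul_def] using this
  rw [Submonoid.smul_def, Submonoid.coe_mul, mul_smul]
  exact hb'

end PseudoNull

section Descent

variable {A : Type u} [CommRing A] [IsDomain A] [IsNoetherianRing A] [UniqueFactorizationMonoid A]
  [UniqueFactorizationMonoid (PowerSeries A)]

omit [IsNoetherianRing A] [UniqueFactorizationMonoid A] [UniqueFactorizationMonoid (PowerSeries A)] in
/-- **The two-variable module is torsion** as soon as it is finitely generated and controls a
torsion module through a map with pseudo-null kernel: some `s` with `s(0) ≠ 0` kills `N`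
(determinant trick on the torsion `A`-module `N/XN`). This DISCHARGES the two-variable torsion
premise of the [FW21]-stub from the one-variable torsion premise of F4♯. [folklore] -/
theorem exists_constantCoeff_ne_zero_of_control
    (N : Type v) [AddCommGroup N] [_root_.Module (PowerSeries A) N] [Module.Finite (PowerSeries A) N]
    (Y : Type w) [AddCommGroup Y] [_root_.Module A Y] (hY : Module.IsTorsion A Y)
    (f : letI : _root_.Module A (QuotSMulTop (PowerSeries.X : PowerSeries A) N) :=
        Module.compHom _ (PowerSeries.C (R := A))
      QuotSMulTop (PowerSeries.X : PowerSeries A) N →ₗ[A] Y)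
    (hker : letI : _root_.Module A (QuotSMulTop (PowerSeries.X : PowerSeries A) N) :=
        Module.compHom _ (PowerSeries.C (R := A))
      IsPseudoNull A (LinearMap.ker f)) :
    ∃ s : PowerSeries A, PowerSeries.constantCoeff s ≠ 0 ∧ ∀ m : N, s • m = 0 := by
  let alg : Algebra A (PowerSeries A) := @MvPowerSeries.instAlgebra Unit A A _ _ (Algebra.id _)
  letI : _root_.Module A N := Module.compHom N (PowerSeries.C (R := A))
  have hIST : @IsScalarTower A (PowerSeries A) N alg.toSMul inferInstance inferInstance :=
    @IsScalarTower.mk _ _ _ alg.toSMul _ _ fun a r m => by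
      rw [@Algebra.smul_def _ _ _ _ alg a r, mul_smul]
      rfl
  refine @exists_constantCoeff_ne_zero_smul_eq_zero A _ _ N _ _ _ _ hIST ?_
  rw [Submodule.ideal_span_singleton_smul]
  exact isTorsion_of_isTorsion_ker_of_surjective f (isTorsion_of_isPseudoNull' hker) hY

omit [IsNoetherianRing A] [UniqueFactorizationMonoid A] [UniqueFactorizationMonoid (PowerSeries A)] in
/-- From a killing element with non-zero constant term to `A⟦X⟧`-torsion. [folklore] -/
theorem isTorsion_of_exists_constantCoeff_ne_zero (N : Type v) [AddCommGroup N]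
    [_root_.Module (PowerSeries A) N]
    (hs : ∃ s : PowerSeries A, PowerSeries.constantCoeff s ≠ 0 ∧ ∀ m : N, s • m = 0) :
    Module.IsTorsion (PowerSeries A) N := by
  obtain ⟨s, hs0, hs⟩ := hs
  have hsne : s ≠ 0 := fun h => hs0 (by rw [h, map_zero])
  exact fun x => ⟨⟨s, mem_nonZeroDivisors_of_ne_zero hsne⟩, hs x⟩

/-- **Descent of the characteristic ideal along `X ↦ 0` through a control map — the algebra of
[JSW17, Cor. 3.4.2] / [SU14, Cor. 3.2.9 (ii)].** Let `A` be a Noetherian factorial domain with `A⟦X⟧`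
factorial, `N` a finitely generated `A⟦X⟧`-module, `Y` a TORSION `A`-module and `f : N/XN → Y` a
SURJECTIVE `A`-linear map with PSEUDO-NULL kernel (the `A`-structure on `N/XN` being the restriction
along the constants `C : A → A⟦X⟧`). Then `ch_A(Y) ⊆ ch_{A⟦X⟧}(N)(0)`, the image of the two-variable
characteristic ideal under `X ↦ 0` ("`chr(X^Σ_ac(M)) ⊂ chr(X^Σ_Gr(𝓜)) mod (γ₊ − 1)`").
Proof: `N/XN` is torsion, so some `s` with `s(0) ≠ 0` kills `N` (determinant trick);
`ch_A(Y) = ch_A(N/XN)` (pseudo-isomorphism invariance) `= ch_A(N[X]) · ch(N)(0)` (the tree's Herbrand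
specialisation formula `PowerSeriesSpecialization.charIdeal_quotSMulTop_eq_mul`) `⊆ ch(N)(0)`. JSW argue
with Fitting ideals ("the kernel of the surjection has finite order … `chr` is the smallest principal
ideal containing the Fitting ideal"); the tree's length-valued `Module.charIdeal` makes the finite (here:
pseudo-null) kernel invisible directly. [cite: JetchevSkinnerWan2017, Cor. 3.4.2 and its proof (arXiv:1512.06894 p. 14)]
[cite: SkinnerUrban2014, Cor. 3.2.9 (ii) (p. 24)] -/
theorem charIdeal_le_map_constantCoeff_of_control
    (N : Type v) [AddCommGroup N] [_root_.Module (PowerSeries A) N] [Module.Finite (PowerSeries A) N]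
    (Y : Type w) [AddCommGroup Y] [_root_.Module A Y] (hY : Module.IsTorsion A Y)
    (f : letI : _root_.Module A (QuotSMulTop (PowerSeries.X : PowerSeries A) N) :=
        Module.compHom _ (PowerSeries.C (R := A))
      QuotSMulTop (PowerSeries.X : PowerSeries A) N →ₗ[A] Y)
    (hf : Surjective f)
    (hker : letI : _root_.Module A (QuotSMulTop (PowerSeries.X : PowerSeries A) N) :=
        Module.compHom _ (PowerSeries.C (R := A))
      IsPseudoNull A (LinearMap.ker f)) :
    charIdeal A Y ≤ (charIdeal (PowerSeries A) N).map (PowerSeries.constantCoeff (R := A)) := by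
  -- the constants algebra `C : A → A⟦X⟧` and the induced `A`-structure on `N`
  let alg : Algebra A (PowerSeries A) := @MvPowerSeries.instAlgebra Unit A A _ _ (Algebra.id _)
  letI : _root_.Module A N := Module.compHom N (PowerSeries.C (R := A))
  have hIST : @IsScalarTower A (PowerSeries A) N alg.toSMul inferInstance inferInstance :=
    @IsScalarTower.mk _ _ _ alg.toSMul _ _ fun a r m => by
      rw [@Algebra.smul_def _ _ _ _ alg a r, mul_smul]
      rfl
  obtain hs := exists_constantCoeff_ne_zero_of_control N Y hY f hker
  -- Herbrand: `ch_A(N/XN) = ch_A(N[X]) · ch(N)(0)`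
  have hH := @charIdeal_quotSMulTop_eq_mul A _ _ _ _ _ N _ _ _ _ hIST hs
  -- pseudo-isomorphism invariance
  have hpi : charIdeal A (QuotSMulTop (PowerSeries.X : PowerSeries A) N) = charIdeal A Y := by
    refine charIdeal_eq_of_arePseudoIsomorphic ⟨f, hker, ?_⟩
    haveI : Subsingleton (Y ⧸ LinearMap.range f) := by
      rw [LinearMap.range_eq_top.mpr hf]
      infer_instance
    exact isPseudoNull_of_subsingleton A _
  rw [← hpi, hH]
  exact Ideal.mul_le_left

/-- The same with an explicit two-variable bound `ch_{A⟦X⟧}(N) ⊆ (L)`: `ch_A(Y) ⊆ (L(0))`.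
[cite: JetchevSkinnerWan2017, Cor. 3.4.2 (arXiv:1512.06894 p. 14)] -/
theorem charIdeal_le_span_constantCoeff_of_control
    (N : Type v) [AddCommGroup N] [_root_.Module (PowerSeries A) N] [Module.Finite (PowerSeries A) N]
    (Y : Type w) [AddCommGroup Y] [_root_.Module A Y] (hY : Module.IsTorsion A Y)
    (f : letI : _root_.Module A (QuotSMulTop (PowerSeries.X : PowerSeries A) N) :=
        Module.compHom _ (PowerSeries.C (R := A))
      QuotSMulTop (PowerSeries.X : PowerSeries A) N →ₗ[A] Y)
    (hf : Surjective f)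
    (hker : letI : _root_.Module A (QuotSMulTop (PowerSeries.X : PowerSeries A) N) :=
        Module.compHom _ (PowerSeries.C (R := A))
      IsPseudoNull A (LinearMap.ker f))
    {L : PowerSeries A} (hL : charIdeal (PowerSeries A) N ≤ Ideal.span {L}) :
    charIdeal A Y ≤ Ideal.span {PowerSeries.constantCoeff L} := by
  refine (charIdeal_le_map_constantCoeff_of_control N Y hY f hf hker).trans ?_
  refine (Ideal.map_mono hL).trans ?_
  rw [Ideal.map_span, Set.image_singleton]

end Descent

section Transport

variable {A : Type u} [CommRing A] {B : Type v} [CommRing B] (φ : A →+* B)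

/-- `constantCoeff ∘ map (map φ) = map φ ∘ constantCoeff` on `A⟦T_a⟧⟦T_c⟧`: extending the coefficients
commutes with `T_c ↦ 0`. [folklore] -/
theorem constantCoeff_comp_map_map :
    (PowerSeries.constantCoeff (R := PowerSeries B)).comp (PowerSeries.map (PowerSeries.map φ)) =
      (PowerSeries.map φ).comp (PowerSeries.constantCoeff (R := PowerSeries A)) := by
  refine RingHom.ext fun F => ?_
  show PowerSeries.constantCoeff (PowerSeries.map (PowerSeries.map φ) F) =
    PowerSeries.map φ (PowerSeries.constantCoeff F)
  rw [← PowerSeries.coeff_zero_eq_constantCoeff_apply, PowerSeries.coeff_map,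
    PowerSeries.coeff_zero_eq_constantCoeff_apply]

/-- Reading an ideal of `A⟦T_a⟧⟦T_c⟧` in `B⟦T_a⟧` two ways: first `T_c ↦ 0` then extend coefficients,
or first extend coefficients then `T_c ↦ 0`. [folklore] -/
theorem map_map_constantCoeff_eq (J : Ideal (PowerSeries (PowerSeries A))) :
    (J.map (PowerSeries.constantCoeff (R := PowerSeries A))).map (PowerSeries.map φ) =
      (J.map (PowerSeries.map (PowerSeries.map φ))).map
        (PowerSeries.constantCoeff (R := PowerSeries B)) := by
  rw [Ideal.map_map, Ideal.map_map, constantCoeff_comp_map_map]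

/-- If `J ⊆ (𝓛₂)` in `B⟦T_a⟧⟦T_c⟧` and `𝓛₂(T_c = 0) = u · Q` with `u` a unit, then `J(T_c = 0) ⊆ (Q)`.
[folklore] -/
theorem map_constantCoeff_le_span_of_le_span_of_eq_unit_mul {J : Ideal (PowerSeries (PowerSeries B))}
    {L₂ : PowerSeries (PowerSeries B)} (hJ : J ≤ Ideal.span {L₂}) {u : (PowerSeries B)ˣ}
    {Q : PowerSeries B} (hu : PowerSeries.constantCoeff L₂ = (u : PowerSeries B) * Q) :
    J.map (PowerSeries.constantCoeff (R := PowerSeries B)) ≤ Ideal.span {Q} := by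
  refine (Ideal.map_mono hJ).trans ?_
  rw [Ideal.map_span, Set.image_singleton, Ideal.span_singleton_le_iff_mem, hu]
  exact Ideal.mul_mem_left _ _ (Ideal.mem_span_singleton_self Q)

end Transport

end TwoVariableDescent

/-! ## §2 Ring-theoretic clauses for `𝒪 = padicCoeffIntegers ι_g`: `𝒪⟦T_a⟧⟦T_c⟧` is factorial -/

namespace CoeffRing

open Literature.NumberTheory.EllipticCurves.ModularForms Literature.NumberTheory.EllipticCurves.GreenbergSelmer
  Literature.NumberTheory.Automorphic

variable {p : ℕ} [Fact p.Prime] {M : ℕ} {k : ℤ} {g : CuspForm (CongruenceSubgroup.Gamma0 M) k}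
  (ιg : coeffField g →+* PadicAlgCl p)

/-- `𝒪_E` is a discrete valuation ring for `E/ℚ_p` finite (local PID in which `p ≠ 0` is not a unit).
[cite: SerreLocalFields1979, Ch. II §2, Prop. 3] -/
theorem isDiscreteValuationRing_unitBall (E : IntermediateField ℚ_[p] (PadicAlgCl p))
    [FiniteDimensional ℚ_[p] E] :
    IsDiscreteValuationRing (PadicIntermediateField.unitBall p E) :=
  haveI : IsPrincipalIdealRing (PadicIntermediateField.unitBall p E) :=
    PadicIntermediateField.isPrincipalIdealRing_unitBall p E
  { not_a_field' := fun h => PadicIntermediateField.natCast_prime_ne_zero p E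
      ((Submodule.eq_bot_iff _).mp h _ (PadicIntermediateField.natCast_prime_mem_maximalIdeal p E)) }

/-- **`𝒪⟦T_a⟧⟦T_c⟧` is factorial** for `𝒪 = padicCoeffIntegers ι_g ≅ 𝒪_{ℚ_p(ι_g K_g)}` with
`ℚ_p(ι_g K_g)/ℚ_p` finite (regular local of dimension `3`, Auslander–Buchsbaum; transported from the
tree's `IwasawaTheory.uniqueFactorizationMonoid_powerSeries_powerSeries` for the DVR `𝒪_{ℚ_p(ι_g K_g)}`
along `exists_ringEquiv_unitBall`). [cite: Matsumura1987, Thm. 20.3] -/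
theorem uniqueFactorizationMonoid_powerSeries_powerSeries
    [FiniteDimensional ℚ_[p] (padicCoeffField ιg)] :
    UniqueFactorizationMonoid (PowerSeries (PowerSeries (padicCoeffIntegers ιg))) := by
  obtain ⟨e, -, -⟩ := GreenbergSelmer.exists_ringEquiv_unitBall ιg
  haveI := isDiscreteValuationRing_unitBall (p := p) (padicCoeffField ιg)
  have h := Literature.NumberTheory.IwasawaTheory.uniqueFactorizationMonoid_powerSeries_powerSeries
    (PadicIntermediateField.unitBall p (padicCoeffField ιg))
  let φ : PowerSeries (PowerSeries (PadicIntermediateField.unitBall p (padicCoeffField ιg))) →+*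
      PowerSeries (PowerSeries (padicCoeffIntegers ιg)) :=
    PowerSeries.map (PowerSeries.map (e.symm : _ →+* padicCoeffIntegers ιg))
  have hφ : Function.Bijective φ :=
    ⟨PowerSeries.map_injective _ (PowerSeries.map_injective _ e.symm.injective),
      PowerSeries.map_surjective _ (PowerSeries.map_surjective _ e.symm.surjective)⟩
  exact (MulEquiv.ofBijective (φ : _ →* _) hφ).uniqueFactorizationMonoid h

/-- `𝒪 = padicCoeffIntegers ι_g` is a principal ideal domain (hence `𝒪⟦T⟧` is factorial, Mathlib).
[cite: NeukirchANT1999, Ch. II (4.8)] -/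
theorem isPrincipalIdealRing [FiniteDimensional ℚ_[p] (padicCoeffField ιg)] :
    IsPrincipalIdealRing (padicCoeffIntegers ιg) :=
  GreenbergSelmer.isPrincipalIdealRing_padicCoeffIntegers ιg

/-- `ℚ_p(ι_g K_g)/ℚ_p` is finite for a NEWFORM `g` (its coefficient field is a number field,
`IsNewform0.finiteDimensional_coeffField_holds`). [cite: Shimura1971, Thm. 3.48] -/
theorem finiteDimensional_padicCoeffField [NeZero M] (hnf : IsNewform0 g) :
    FiniteDimensional ℚ_[p] (padicCoeffField ιg) := by
  haveI : FiniteDimensional ℚ (coeffField g) := IsNewform0.finiteDimensional_coeffField_holds hnf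
  exact GreenbergSelmer.finiteDimensional_padicCoeffField ιg

end CoeffRing


end Summit.BirchSwinnertonDyer.BirchSwinnertonDyer.Theorems.ErratumThm23TwoVariable

end
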